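import Mathlib
import Literature.Analysis.Complex.EntireQuotientOrder
import Literature.Analysis.Complex.OmittedValuesGrowth
import HarnessLib

/-!
# Route `AlmostPrimeZeros`, crux `SystemMomentDeficit` (stmt-Parity-11326), line `Sketch`
# (idea `small-circle-jensen`): the Poisson–Jensen bound inside the circle
# (`stub_poissonJensenBound`)

Pure complex analysis.  For `P ∈ ℂ[z]` with `P(1) ≠ 0`, a real tilt `a` and the entire function
`H(z) = P(z) e^{−a(z−1)} / P(1)`: if the angular mean of `log⁺ ‖H‖` over the circle `‖z − 1‖ = r`
is at most `A`, then `‖H(w)‖ ≤ e^{3A}` for `‖w − 1‖ ≤ r/2`.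

Proof.  We prove the statement for an arbitrary function `F` holomorphic about the closed disc
`‖z − c‖ ≤ r` (`norm_le_exp_of_circleAverage_posLog_le`).  If `F(w) = 0` there is nothing to
show.  Otherwise `F` has finitely many zeros in the closed disc, so all but finitely many radii
`t ∈ (‖w − c‖, r]` carry no zero of `F` on the circle `‖z − c‖ = t`; for such `t` the
Poisson–Jensen inequality in supremum form
(`Literature.Analysis.Complex.log_norm_le_ratio_mul_circleAverage_posLog`: the Poisson integral of
`log⁺ ‖F‖` dominates the subharmonic `log ‖F‖`, and the Poisson kernel is at most
`(t + d)/(t − d)`, `d = ‖w − c‖`) together with the monotonicity of the mean proximity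
`t ↦ ⨍_{‖z−c‖=t} log⁺ ‖F‖` in the radius
(`Literature.Analysis.Complex.circleAverage_posLog_norm_mono`, moved to the centre `c`) gives
`log ‖F(w)‖ ≤ (t + d)/(t − d) · A`.  Letting `t → r⁻` through good radii yields
`log ‖F(w)‖ ≤ (r + d)/(r − d) · A ≤ 3A` since `d ≤ r/2`.

References: E. C. Titchmarsh, *The Theory of Functions*, 2nd ed., §3.62 (Poisson–Jensen formula);
L. A. Rubel, J. E. Colliander, *Entire and Meromorphic Functions*, Ch. 7–8.
-/

noncomputable section

open Complex Set Metric Filter Topology Real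

namespace Summit.Parity.BatemanHorn.Cruxes.SystemMomentDeficit.SmallCircle

/-- Monotonicity of the mean proximity in the radius at an arbitrary centre: for `F` holomorphic
about the closed disc `‖z − c‖ ≤ ρ` and `0 < r ≤ ρ`,
`⨍_{‖z−c‖=r} log⁺ ‖F‖ ≤ ⨍_{‖z−c‖=ρ} log⁺ ‖F‖` (the centre-`0` statement
`Literature.Analysis.Complex.circleAverage_posLog_norm_mono` translated by `c`). [folklore] -/
private theorem circleAverage_posLog_norm_mono_center {F : ℂ → ℂ} {c : ℂ} {r ρ : ℝ}
    (hr : 0 < r) (hrρ : r ≤ ρ) (hF : AnalyticOnNhd ℂ F (closedBall c ρ)) :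
    circleAverage (fun z => log⁺ ‖F z‖) c r ≤ circleAverage (fun z => log⁺ ‖F z‖) c ρ := by
  have hG : AnalyticOnNhd ℂ (fun z => F (z + c)) (closedBall 0 ρ) := by
    intro z hz
    have hzc : z + c ∈ closedBall c ρ := by
      rw [mem_closedBall, dist_eq_norm, add_sub_cancel_right]
      simpa using hz
    exact (hF _ hzc).comp_of_eq (analyticAt_id.add analyticAt_const) rfl
  have h := Literature.Analysis.Complex.circleAverage_posLog_norm_mono hr hrρ hG
  have e : ∀ t : ℝ, circleAverage (fun z => log⁺ ‖F (z + c)‖) 0 t =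
      circleAverage (fun z => log⁺ ‖F z‖) c t := fun t =>
    circleAverage_map_add_const (f := fun z => log⁺ ‖F z‖) (c := c) (R := t)
  rwa [e r, e ρ] at h

/-- **Poisson–Jensen bound inside the circle.**  Let `F` be holomorphic about the closed disc
`‖z − c‖ ≤ r` (`r > 0`) with `⨍_{‖z−c‖=r} log⁺ ‖F‖ ≤ A` (`A ≥ 0`).  Then `‖F(w)‖ ≤ e^{3A}`
whenever `‖w − c‖ ≤ r/2`: by the Poisson–Jensen inequality at the good radii `t < r` (no zero of
`F` on `‖z − c‖ = t`), `log ‖F(w)‖ ≤ (t + d)/(t − d) · ⨍_{‖z−c‖=t} log⁺ ‖F‖ ≤ (t + d)/(t − d) · A`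
with `d = ‖w − c‖`, and `(t + d)/(t − d) → (r + d)/(r − d) ≤ 3` as `t → r⁻`.
[Titchmarsh, Theory of Functions §3.62] -/
private theorem norm_le_exp_of_circleAverage_posLog_le {F : ℂ → ℂ} {c : ℂ} {r A : ℝ}
    (hr : 0 < r) (hA : 0 ≤ A) (hF : AnalyticOnNhd ℂ F (closedBall c r))
    (hm : circleAverage (fun z => log⁺ ‖F z‖) c r ≤ A) {w : ℂ} (hw : ‖w - c‖ ≤ r / 2) :
    ‖F w‖ ≤ Real.exp (3 * A) := by
  rcases eq_or_ne (F w) 0 with hw0 | hw0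
  · rw [hw0, norm_zero]; exact (Real.exp_pos _).le
  have hFw : 0 < ‖F w‖ := norm_pos_iff.mpr hw0
  rw [← Real.log_le_iff_le_exp hFw]
  have hdr : ‖w - c‖ < r := by linarith
  have hd0 : 0 ≤ ‖w - c‖ := norm_nonneg _
  have hwr : w ∈ closedBall c r := by
    rw [mem_closedBall, dist_eq_norm]; exact hdr.le
  -- finitely many zeros in the closed disc; the finitely many bad radii
  have hfin := Literature.Analysis.Complex.finite_zeros_of_analyticOnNhd_closedBall hF ⟨w, hwr, hw0⟩
  obtain ⟨B, hB⟩ : ∃ B : Finset ℝ, B = hfin.toFinset.image fun u => ‖u - c‖ := ⟨_, rfl⟩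
  have hgood : ∀ t : ℝ, t ≤ r → t ∉ B → ∀ z ∈ sphere c t, F z ≠ 0 := by
    intro t htr htB z hz h0
    have hzt : ‖z - c‖ = t := by rwa [mem_sphere, dist_eq_norm] at hz
    apply htB
    rw [hB, Finset.mem_image]
    refine ⟨z, hfin.mem_toFinset.mpr ⟨?_, h0⟩, hzt⟩
    rw [mem_closedBall, dist_eq_norm, hzt]
    exact htr
  -- the mean proximity is at most `A` at every radius `0 < t ≤ r`
  have hmt : ∀ t : ℝ, 0 < t → t ≤ r → circleAverage (fun z => log⁺ ‖F z‖) c t ≤ A :=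
    fun t ht htr => (circleAverage_posLog_norm_mono_center ht htr hF).trans hm
  -- Poisson–Jensen in supremum form at every good radius `t ∈ (‖w - c‖, r]`
  have hPJ : ∀ t : ℝ, ‖w - c‖ < t → t ≤ r → t ∉ B →
      Real.log ‖F w‖ ≤ (t + ‖w - c‖) / (t - ‖w - c‖) * A := by
    intro t hdt htr htB
    have ht0 : 0 < t := lt_of_le_of_lt hd0 hdt
    have hwt : w ∈ ball c t := by rw [mem_ball, dist_eq_norm]; exact hdt
    have key := Literature.Analysis.Complex.log_norm_le_ratio_mul_circleAverage_posLog ht0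
      (hF.mono (closedBall_subset_closedBall htr)) (hgood t htr htB) hwt
    refine key.trans ?_
    have hK : 0 ≤ (t + ‖w - c‖) / (t - ‖w - c‖) := div_nonneg (by linarith) (by linarith)
    exact mul_le_mul_of_nonneg_left (hmt t ht0 htr) hK
  -- pass to the limit `t → r⁻` through good radii
  have hlim : Tendsto (fun t : ℝ => (t + ‖w - c‖) / (t - ‖w - c‖) * A) (𝓝[<] r)
      (𝓝 ((r + ‖w - c‖) / (r - ‖w - c‖) * A)) := by
    refine Tendsto.mono_left ?_ nhdsWithin_le_nhds
    have hne : r - ‖w - c‖ ≠ 0 := by linarith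
    have hc : ContinuousAt (fun t : ℝ => (t + ‖w - c‖) / (t - ‖w - c‖) * A) r := by
      refine ContinuousAt.mul (ContinuousAt.div (by fun_prop) (by fun_prop) hne) ?_
      exact continuousAt_const
    exact hc.tendsto
  have hev : ∀ᶠ t in 𝓝[<] r, Real.log ‖F w‖ ≤ (t + ‖w - c‖) / (t - ‖w - c‖) * A := by
    have h1 : ∀ᶠ t in 𝓝[<] r, t < r := eventually_nhdsWithin_of_forall fun t ht => ht
    have h2 : ∀ᶠ t in 𝓝[<] r, ‖w - c‖ < t := (lt_mem_nhds hdr).filter_mono nhdsWithin_le_nhds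
    have h3 : ∀ᶠ t in 𝓝[<] r, ∀ b ∈ B.erase r, t ≠ b := by
      rw [Filter.eventually_all_finset]
      intro b hb
      exact (eventually_ne_nhds (Finset.ne_of_mem_erase hb).symm).filter_mono nhdsWithin_le_nhds
    filter_upwards [h1, h2, h3] with t ht1 ht2 ht3
    refine hPJ t ht2 ht1.le fun htB => ?_
    exact ht3 t (Finset.mem_erase.mpr ⟨ht1.ne, htB⟩) rfl
  have hle : Real.log ‖F w‖ ≤ (r + ‖w - c‖) / (r - ‖w - c‖) * A := ge_of_tendsto hlim hev
  refine hle.trans ?_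
  have h3 : (r + ‖w - c‖) / (r - ‖w - c‖) ≤ 3 := by
    rw [div_le_iff₀ (by linarith)]
    linarith
  exact mul_le_mul_of_nonneg_right h3 hA

/-- **Stub `stub_poissonJensenBound` of the line `Sketch` (Poisson–Jensen inequality inside the
circle).**  For `P ∈ ℂ[X]` with `P(1) ≠ 0`, a real tilt `a`, `r > 0`, `A ≥ 0` and the entire
function `H(z) = P(z) e^{−a(z−1)} / P(1)`: if `⨍_{‖z−1‖=r} log⁺ ‖H‖ ≤ A` then `‖H(w)‖ ≤ e^{3A}` on
`‖w − 1‖ ≤ r/2`.  (Poisson–Jensen: `log ‖H(w)‖` is dominated by the Poisson integral of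
`log⁺ ‖H‖`, whose kernel is at most `(r + ‖w−1‖)/(r − ‖w−1‖) ≤ 3`; zeros of `H` on the circle are
handled by approximating `r` from inside through zero-free radii and the monotonicity of the mean
proximity in the radius.) [Titchmarsh, Theory of Functions §3.62] -/
theorem stub_poissonJensenBound :
    ∀ (P : Polynomial ℂ) (r a A : ℝ), 0 < r → 0 ≤ A → P.eval 1 ≠ 0 →
      Real.circleAverage (fun z : ℂ => Real.posLog
        ‖P.eval z * Complex.exp (-((a : ℂ) * (z - 1))) / P.eval 1‖) 1 r ≤ A →
      ∀ w : ℂ, ‖w - 1‖ ≤ r / 2 →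
        ‖P.eval w * Complex.exp (-((a : ℂ) * (w - 1))) / P.eval 1‖ ≤ Real.exp (3 * A) := by
  intro P r a A hr hA _hP1 hm w hw
  have hdiff : Differentiable ℂ
      (fun z : ℂ => P.eval z * Complex.exp (-((a : ℂ) * (z - 1))) / P.eval 1) :=
    ((Polynomial.differentiable P).mul (by fun_prop)).div_const _
  have hF : AnalyticOnNhd ℂ
      (fun z : ℂ => P.eval z * Complex.exp (-((a : ℂ) * (z - 1))) / P.eval 1)
      (closedBall (1 : ℂ) r) := fun z _ => hdiff.analyticAt z
  exact norm_le_exp_of_circleAverage_posLog_le hr hA hF hm hw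

end Summit.Parity.BatemanHorn.Cruxes.SystemMomentDeficit.SmallCircle

end
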